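import Literature.AlgebraicGeometry.Frobenioids.ModelFrobenioidFunctor
import Literature.AlgebraicGeometry.Frobenioids.ElementaryIsFrobenioid
import Literature.AlgebraicGeometry.Frobenioids.BiratGerms
import HarnessLib

/-!
# Frobenioids I, Theorem 5.2 (ii), first sentence — part 1: the model Frobenioid as a
# pre-Frobenioid (abc-iut cell, layer L1, node F-D1a)

Mochizuki, *The geometry of Frobenioids I: the general theory*, Kyushu J. Math. **62** (2008)
293–400, §5, Theorem 5.2 (i)–(ii), kurims text pp. 100–101 [cite: MochizukiFrdI2008, Thm. 5.2(ii) p.101]: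

> "(ii) The category `C` is a Frobenioid [with respect to the functor `C → F_Φ`] of isotropic …
> type." — "Proof. Assertions (i), (ii) follow via a routine verification [which, in the case of
> assertion (ii), is reminiscent of the verification that "elementary Frobenioids are Frobenioids"
> in Proposition 1.5, (i)] … Here, we observe that the objects `A = (A_D, α)` such that `α = 0`
> are Frobenius-trivial …"

This file carries out the first half of that routine verification for the category
`ModelFrobenioid Φ B DivB` of Thm. 5.2 (i) (`ModelFrobenioid.lean`) and its functor `C → F_Φ`
(`ModelFrobenioid.toElem`, `ModelFrobenioidFunctor.lean`, with the zero section `A_D ↦ (A_D, 0)`):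
a dictionary for the `PreFrobenioid` vocabulary, the isomorphisms of `C` (`(1, f, 0, u)` with `f` invertible), and
"every object is isotropic, every arrow co-angular"; the pull-back morphisms of `C` and the
standing hypotheses of Def. 1.1 (iv)/1.3 (`C` connected and totally epimorphic) follow in
`ModelFrobenioidPullbacks.lean`. Hypotheses are those printed in Thm. 5.2: `Φ` a divisorial monoid on `D`, `B` a
group-like monoid on `D`, `Div_B : B → Φ^gp`, `D` connected and totally epimorphic (each lemma
takes only the ones it uses). Dictionary as in `ModelFrobenioid.lean` (multiplicative monoids,
diagrammatic composition). The clauses (i)–(vii) of Def. 1.3 and the theorem itself are in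
`ModelFrobenioidDivision.lean`, `ModelFrobenioidOrder.lean`, `ModelFrobenioidIsFrobenioid.lean`. No statement of the paper is strengthened.
-/

noncomputable section

namespace Literature.AlgebraicGeometry.Frobenioids

open CategoryTheory Opposite

universe w v u

/-! ### Two facts about monoids -/

section Monoids

variable {M : Type w} [CommMonoid M]

/-- In a group-like monoid (`M^char = 0`, FrdI Def. 1.1 (i)) every element is a unit.
[cite: MochizukiFrdI2008, Def. 1.1(i)] -/
theorem IsGroupLike.isUnit (h : IsGroupLike M) (b : M) : IsUnit b := by
  obtain ⟨u, hu⟩ : Associated b 1 := Associates.mk_eq_mk_iff_associated.mp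
    (@Subsingleton.elim _ h.subsingleton_associates (Associates.mk b) (Associates.mk 1))
  exact IsUnit.of_mul_eq_one _ hu

/-- Every element of `M^gp` is a fraction of two elements of `M` (`M^gp`, FrdI §0 p. 11).
[cite: MochizukiFrdI2008, §0 p.11] -/
theorem gp_exists_mul_of_eq_of (c : Algebra.GrothendieckGroup M) :
    ∃ a b : M, c * Algebra.GrothendieckGroup.of b = Algebra.GrothendieckGroup.of a := by
  induction c using Localization.induction_on with
  | H p =>
    refine ⟨p.1, p.2, ?_⟩
    rw [Localization.mk_eq_monoidOf_mk'_apply]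
    exact Submonoid.LocalizationMap.mk'_spec _ p.1 p.2

/-- In `N_{≥1}` (FrdI §0 p. 10), `m n = 1` forces `m = 1`. [cite: MochizukiFrdI2008, §0 p.10] -/
theorem pnat_eq_one_of_mul_eq_one {m n : ℕ+} (h : m * n = 1) : m = 1 :=
  PNat.eq (by
    rw [PNat.one_coe]
    exact Nat.eq_one_of_mul_eq_one_right (by rw [← PNat.mul_coe, h, PNat.one_coe]))

end Monoids

namespace ModelFrobenioid

variable {D : Type u} [Category.{v} D] {Φ B : Dᵒᵖ ⥤ CommMonCat.{w}} {DivB : B ⟶ monoidGp Φ}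

/-! ### Normal forms: everything through `pull` (`pullGp_of'`, `pullGp_inv_pullGp`, `pullGp_pullGp_inv`,
`pullGp_injective` are in `BiratGerms.lean`, seat abc-iut-L1-t10) -/

open PreFrobenioid (pullGp_of' pullGp_inv_pullGp pullGp_pullGp_inv pullGp_injective)

/-- Naturality of `Div_B`, through `pull`. [cite: MochizukiFrdI2008, Thm. 5.2 p.100] -/
theorem pullGp_divB_pull {X Y : D} (f : X ⟶ Y) (u : B.obj (op Y)) :
    pullGp Φ f (divB Φ B DivB (op Y) u) = divB Φ B DivB (op X) (pull B f u) :=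
  pullGp_divB f u

section Morphisms

variable {X Y Z : ModelFrobenioid Φ B DivB}

/-- `Div(ψ ∘ φ) = Base(φ)^* Div(ψ) + deg_Fr(ψ) · Div(φ)`, through `pull`.
[cite: MochizukiFrdI2008, Thm. 5.2(i) p.100] -/
theorem div_comp_pull (φ : X ⟶ Y) (ψ : Y ⟶ Z) :
    div (φ ≫ ψ) = pull Φ (baseMap φ) (div ψ) * div φ ^ (degFr ψ : ℕ) := rfl

/-- `u_{ψ ∘ φ} = Base(φ)^* u_ψ + deg_Fr(ψ) · u_φ`, through `pull`.
[cite: MochizukiFrdI2008, Thm. 5.2(i) p.100] -/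
theorem unit_comp_pull (φ : X ⟶ Y) (ψ : Y ⟶ Z) :
    unit (φ ≫ ψ) = pull B (baseMap φ) (unit ψ) * unit φ ^ (degFr ψ : ℕ) := rfl

variable (X Y) in
/-- Constructor for morphisms of the model Frobenioid from the data (a)–(d) and the relation (d).
[cite: MochizukiFrdI2008, Thm. 5.2(i) p.100] -/
def mkHom (n : ℕ+) (f : X.base ⟶ Y.base) (x : Φ.obj (op X.base)) (u : B.obj (op X.base))
    (h : X.cls ^ (n : ℕ) * Algebra.GrothendieckGroup.of x =
      pullGp Φ f Y.cls * divB Φ B DivB (op X.base) u) : X ⟶ Y :=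
  ⟨n, f, x, u, h⟩

/-- Components of `mkHom`. [cite: MochizukiFrdI2008, Thm. 5.2(i) p.100] -/
@[simp] theorem degFr_mkHom (n : ℕ+) (f : X.base ⟶ Y.base) (x : Φ.obj (op X.base))
    (u : B.obj (op X.base)) (h) : degFr (mkHom X Y n f x u h) = n := rfl

/-- Components of `mkHom`. [cite: MochizukiFrdI2008, Thm. 5.2(i) p.100] -/
@[simp] theorem baseMap_mkHom (n : ℕ+) (f : X.base ⟶ Y.base) (x : Φ.obj (op X.base))
    (u : B.obj (op X.base)) (h) : baseMap (mkHom X Y n f x u h) = f := rfl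

/-- Components of `mkHom`. [cite: MochizukiFrdI2008, Thm. 5.2(i) p.100] -/
@[simp] theorem div_mkHom (n : ℕ+) (f : X.base ⟶ Y.base) (x : Φ.obj (op X.base))
    (u : B.obj (op X.base)) (h) : div (mkHom X Y n f x u h) = x := rfl

/-- Components of `mkHom`. [cite: MochizukiFrdI2008, Thm. 5.2(i) p.100] -/
@[simp] theorem unit_mkHom (n : ℕ+) (f : X.base ⟶ Y.base) (x : Φ.obj (op X.base))
    (u : B.obj (op X.base)) (h) : unit (mkHom X Y n f x u h) = u := rfl

end Morphisms

/-! ### The functor `C → F_Φ` (`ModelFrobenioidFunctor.lean`): dictionary for `PreFrobenioid.*` -/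

section Dictionary

variable {X Y : ModelFrobenioid Φ B DivB}

/-- The base object of `(A_D, α)` for `C → F_Φ` is `A_D`. [cite: MochizukiFrdI2008, Thm. 5.2(i) p.100] -/
theorem baseObj_toElem (X : ModelFrobenioid Φ B DivB) :
    PreFrobenioid.baseObj (toElem Φ B DivB) X = X.base := rfl

/-- `Base` for `C → F_Φ` is `Base(φ)`. [cite: MochizukiFrdI2008, Thm. 5.2(i) p.100] -/
theorem base_toElem (φ : X ⟶ Y) : PreFrobenioid.Base (toElem Φ B DivB) φ = baseMap φ := rfl

/-- `Div` for `C → F_Φ` is `Div(φ)`. [cite: MochizukiFrdI2008, Thm. 5.2(i) p.100] -/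
theorem div_toElem (φ : X ⟶ Y) : PreFrobenioid.Div (toElem Φ B DivB) φ = div φ := rfl

/-- `deg_Fr` for `C → F_Φ` is `deg_Fr(φ)`. [cite: MochizukiFrdI2008, Thm. 5.2(i) p.100] -/
theorem degFr_toElem (φ : X ⟶ Y) : PreFrobenioid.degFr (toElem Φ B DivB) φ = degFr φ := rfl

end Dictionary

/-! ### The zero section `A_D ↦ (A_D, 0)` (`ModelFrobenioidFunctor.lean`) -/

/-- The zero section is a section of `C → D`. [cite: MochizukiFrdI2008, Thm. 5.2 p.101] -/
@[simp] theorem zeroSection_obj_base (A : D) : ((zeroSection Φ B DivB).obj A).base = A := rfl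

/-- The class of `(A_D, 0)` is `0`. [cite: MochizukiFrdI2008, Thm. 5.2 p.101] -/
@[simp] theorem zeroSection_obj_cls (A : D) : ((zeroSection Φ B DivB).obj A).cls = 1 := rfl

/-- The zero section on objects. [cite: MochizukiFrdI2008, Thm. 5.2 p.101] -/
theorem zeroSection_obj (A : D) : (zeroSection Φ B DivB).obj A = zeroObj Φ B DivB A := rfl

/-! ### Isomorphisms of `C` -/

section Isos

variable {X Y : ModelFrobenioid Φ B DivB}

/-- An isomorphism of `C` has Frobenius degree `1`. [cite: MochizukiFrdI2008, Thm. 5.2(ii) p.101] -/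
theorem degFr_eq_one_of_isIso (φ : X ⟶ Y) [IsIso φ] : degFr φ = 1 :=
  ElemFrobenioid.degFr_eq_one_of_isIso ((toElem Φ B DivB).map φ)

/-- An isomorphism of `C` projects to an isomorphism of `D`. [cite: MochizukiFrdI2008, Thm. 5.2(ii) p.101] -/
theorem isIso_baseMap_of_isIso (φ : X ⟶ Y) [IsIso φ] : IsIso (baseMap φ) :=
  (inferInstance : IsIso ((baseFunctor Φ B DivB).map φ))

/-- An isomorphism of `C` has zero divisor `0` when `Φ` is divisorial (sharp).
[cite: MochizukiFrdI2008, Thm. 5.2(ii) p.101] -/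
theorem div_eq_one_of_isIso (hΦd : Objectwise (fun M _ => IsDivisorial M) Φ) (φ : X ⟶ Y)
    [IsIso φ] : div φ = 1 :=
  (hΦd X.base).isSharp.eq_one_of_isUnit _
    (ElemFrobenioid.isUnit_div_of_isIso ((toElem Φ B DivB).map φ))

/-- A morphism `(1, f, 0, u)` of `C` with `f` an isomorphism of `D` is an isomorphism (its inverse
is `(1, f⁻¹, 0, -(f⁻¹)^* u)`; `B` group-like). [cite: MochizukiFrdI2008, Thm. 5.2(ii) p.101] -/
theorem isIso_of (hBg : Objectwise (fun M _ => IsGroupLike M) B) (φ : X ⟶ Y) [IsIso (baseMap φ)]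
    (hd : div φ = 1) (hn : degFr φ = 1) : IsIso φ := by
  obtain ⟨uu, huu⟩ := (hBg X.base).isUnit (unit φ)
  have hφ : X.cls = pullGp Φ (baseMap φ) Y.cls * divB Φ B DivB _ (unit φ) := by
    have h := rel φ
    rwa [hn, hd, PNat.one_coe, pow_one, map_one, mul_one] at h
  refine ⟨⟨mkHom Y X 1 (inv (baseMap φ)) 1 (pull B (inv (baseMap φ)) ↑uu⁻¹) ?_, ?_, ?_⟩⟩
  · rw [PNat.one_coe, pow_one, map_one, mul_one, ← pullGp_divB_pull, hφ, map_mul (pullGp Φ _),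
      pullGp_inv_pullGp, mul_assoc, ← map_mul, ← map_mul, ← huu, Units.mul_inv, map_one, map_one,
      mul_one]
  · refine hom_ext ?_ (IsIso.hom_inv_id _) ?_ ?_
    · show (1 : ℕ+) * degFr φ = 1
      rw [hn, mul_one]
    · show pull Φ (baseMap φ) 1 * div φ ^ ((1 : ℕ+) : ℕ) = 1
      rw [map_one, one_mul, PNat.one_coe, pow_one, hd]
    · show pull B (baseMap φ) (pull B (inv (baseMap φ)) ↑uu⁻¹) * unit φ ^ ((1 : ℕ+) : ℕ) = 1
      rw [← pull_comp, IsIso.hom_inv_id, pull_id, PNat.one_coe, pow_one, ← huu, Units.inv_mul]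
  · refine hom_ext ?_ (IsIso.inv_hom_id _) ?_ ?_
    · show degFr φ * 1 = 1
      rw [hn, mul_one]
    · show pull Φ (inv (baseMap φ)) (div φ) * 1 ^ (degFr φ : ℕ) = 1
      rw [hd, map_one, one_pow, mul_one]
    · show pull B (inv (baseMap φ)) (unit φ) * (pull B (inv (baseMap φ)) ↑uu⁻¹) ^ (degFr φ : ℕ) = 1
      rw [hn, PNat.one_coe, pow_one, ← map_mul, ← huu, Units.mul_inv, map_one]

/-- An isometric pre-step of `C` is an isomorphism. [cite: MochizukiFrdI2008, Thm. 5.2(ii) p.101] -/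
theorem isIso_of_isIsometry_of_isPreStep (hBg : Objectwise (fun M _ => IsGroupLike M) B)
    {φ : X ⟶ Y} (h₁ : PreFrobenioid.IsIsometry (toElem Φ B DivB) φ)
    (h₂ : PreFrobenioid.IsPreStep (toElem Φ B DivB) φ) : IsIso φ :=
  haveI : IsIso (baseMap φ) := h₂.2
  isIso_of hBg φ h₁ h₂.1

/-- Every object of `C` is isotropic ("of isotropic type", Thm. 5.2 (ii)).
[cite: MochizukiFrdI2008, Thm. 5.2(ii) p.101] -/
theorem isIsotropic (hBg : Objectwise (fun M _ => IsGroupLike M) B) (X : ModelFrobenioid Φ B DivB) :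
    PreFrobenioid.IsIsotropic (toElem Φ B DivB) X :=
  fun _ _ h₁ h₂ => isIso_of_isIsometry_of_isPreStep hBg h₁ h₂

/-- Every morphism of `C` is co-angular. [cite: MochizukiFrdI2008, Thm. 5.2(ii) p.101] -/
theorem isCoAngular (hBg : Objectwise (fun M _ => IsGroupLike M) B) (φ : X ⟶ Y) :
    PreFrobenioid.IsCoAngular (toElem Φ B DivB) φ :=
  fun _ _ _ _ _ _ _ h₁ h₂ _ => isIso_of_isIsometry_of_isPreStep hBg h₁ h₂

/-- Identities are pre-steps. [cite: MochizukiFrdI2008, Thm. 5.2(ii) p.101] -/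
theorem isPreStep_id (X : ModelFrobenioid Φ B DivB) : PreFrobenioid.IsPreStep (toElem Φ B DivB) (𝟙 X) :=
  ⟨rfl, show IsIso (𝟙 X.base) from inferInstance⟩

/-- Identities are isometries. [cite: MochizukiFrdI2008, Thm. 5.2(ii) p.101] -/
theorem isIsometry_id (X : ModelFrobenioid Φ B DivB) :
    PreFrobenioid.IsIsometry (toElem Φ B DivB) (𝟙 X) := rfl

end Isos

end ModelFrobenioid

end Literature.AlgebraicGeometry.Frobenioids
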